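import Summits.FinalStateConjecture.FinalStateConjecture.Theorems.PhotonSphereChannelsChannelsResolveTameDevelopmentsROutgoingEnergyExhaustion

/-!
# Route PhotonSphereChannels · crux `ChannelsResolveTameDevelopmentsR` (stmt-FinalStateConjecture-14075) ·
# line `isolated-kerr-connected-hull`: the round-1 "first lemmas" of the crux cards, now theorems

Two corollaries of the landed linear silent rigidity `RW.futureSilentWavesVanish`
(`…ROutgoingEnergyExhaustion`, p94152; forward silence through the bare cone at every centre ⇒ `ψ ≡ 0`):

* `RW.eternalSilentWavesVanish` — VERBATIM the first lemma `EternalSilentWavesVanish` of the crux card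
  `isolated-kerr-connected-hull` (ideator 2) as transcribed in `Cruxes/ChannelsResolveTameDevelopmentsR/
  Disproof.lean` §7.1 (two-sided silence from aperture `ρ₀ ≥ 0` at every centre ⇒ `ψ ≡ 0`): the forward
  half of the hypothesis at aperture `ρ₀` and centre `T + ρ₀` is forward silence at aperture `0` and
  centre `T` (aperture shift, as in `Negative.SilenceCalculus.channelEnergy_aperture_top`, p81766,
  reproved here in three private lemmas to keep the import list minimal).
* `RW.silentModesAreStatic` — VERBATIM the first lemma `SilentModesAreStatic` of the card
  `kerr-isolation-dichotomy` (ideator 1; Disproof §7.1): its channel-inequality hypothesis is not needed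
  (the Disproof's `silentModesAreStatic_of_eternalSilentWavesVanish`, now unconditional).

So the linear "first provable rungs" of all three silence cards of this crux (`SilentModesAreStatic`,
`EternalSilentWavesVanish` ≡ `EternalDarkModesVanish`) are closed. No definition, no named fact.
-/

noncomputable section

-- every `Summit.FinalStateConjecture.FinalStateConjecture.…` name repeats the summit = sub-problem
-- segment (D-0017 layout), as in every landed `…Theorems` file of this route
set_option linter.dupNamespace false

open Set Filter Topology MeasureTheory
open scoped ENNReal

namespace Summit.FinalStateConjecture.FinalStateConjecture.Theorems

open Literature.Geometry.Lorentzian Literature.Geometry.Lorentzian.ReggeWheeler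

namespace RW

/-- Energy density of the time-shifted function at time `t` (cf. `Negative.energyDensity_shift_at`,
p81766). [folklore] -/
private theorem energyDensity_shift_at₁ (V : ℝ → ℝ) (ψ : ℝ → ℝ → ℝ) (a t x : ℝ) :
    energyDensity V (fun s y ↦ ψ (a + s) y) t x = energyDensity V ψ (a + t) x := by
  unfold energyDensity
  have key : ∀ f : ℝ → ℝ, deriv (fun τ ↦ f (a + τ)) t = deriv f (a + t) := fun f ↦ by
    rw [deriv_comp_const_add]
  have hd : deriv (fun τ ↦ ψ (a + τ) x) t = deriv (fun τ ↦ ψ τ x) (a + t) := key fun σ ↦ ψ σ x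
  simp only [hd]

/-- Forward exterior energies: aperture `ρ ≥ 0` at centre `T` = aperture `0` at centre `T − ρ`
(cf. `Negative.exteriorEnergy_aperture_top`, p81766). [folklore] -/
private theorem exteriorEnergy_aperture_top₁ (V : ℝ → ℝ) (ψ : ℝ → ℝ → ℝ) (xc : ℝ) {ρ : ℝ}
    (hρ : 0 ≤ ρ) (T : ℝ) {t : ℝ} (ht : 0 ≤ t) :
    exteriorEnergy V xc ρ (fun s y ↦ ψ (T + s) y) t =
      exteriorEnergy V xc 0 (fun s y ↦ ψ (T - ρ + s) y) (t + ρ) := by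
  unfold exteriorEnergy
  have hset : {x : ℝ | ρ + |t| < |x - xc|} = {x : ℝ | 0 + |t + ρ| < |x - xc|} := by
    ext x
    simp only [mem_setOf_eq]
    rw [abs_of_nonneg ht, abs_of_nonneg (show 0 ≤ t + ρ by linarith), zero_add, add_comm]
  rw [hset]
  refine MeasureTheory.lintegral_congr fun x ↦ ?_
  rw [energyDensity_shift_at₁, energyDensity_shift_at₁, show T - ρ + (t + ρ) = T + t by ring]

/-- Forward channel energies: aperture `ρ ≥ 0` at centre `T` = aperture `0` at centre `T − ρ`
(cf. `Negative.channelEnergy_aperture_top`, p81766). [folklore] -/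
private theorem channelEnergy_aperture_top₁ (V : ℝ → ℝ) (ψ : ℝ → ℝ → ℝ) (xc : ℝ) {ρ : ℝ}
    (hρ : 0 ≤ ρ) (T : ℝ) :
    channelEnergy V xc ρ (fun s y ↦ ψ (T + s) y) atTop =
      channelEnergy V xc 0 (fun s y ↦ ψ (T - ρ + s) y) atTop := by
  unfold channelEnergy
  have h1 : liminf (exteriorEnergy V xc ρ (fun s y ↦ ψ (T + s) y)) atTop =
      liminf ((exteriorEnergy V xc 0 (fun s y ↦ ψ (T - ρ + s) y)) ∘ fun t ↦ t + ρ) atTop := by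
    refine liminf_congr ?_
    filter_upwards [eventually_ge_atTop (0 : ℝ)] with t ht
    exact exteriorEnergy_aperture_top₁ V ψ xc hρ T ht
  rw [h1, liminf_comp, map_add_atTop_eq]

/-- **`EternalSilentWavesVanish`** (first lemma of the crux card `isolated-kerr-connected-hull`,
VERBATIM the transcription `Disproof.EternalSilentWavesVanish`, now a theorem): a finite-energy global `C²`
Regge–Wheeler solution (`s ≤ 2`, `ℓ ≥ s`) which at EVERY centre `T` is silent through every two-ended
channel of aperture `ρ ≥ ρ₀ ≥ 0` (no radiation through `𝓘⁺ ∪ 𝓗⁺` nor from `𝓘⁻ ∪ 𝓗⁻`) vanishes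
identically. Only the forward half of the hypothesis is used (`RW.futureSilentWavesVanish`). [folklore] -/
theorem eternalSilentWavesVanish :
    ∀ M : ℝ, 0 < M → ∀ (r : ℝ → ℝ) (xc : ℝ), IsTortoiseRadius M r xc → ∀ (s ℓ : ℕ), s ≤ 2 → s ≤ ℓ →
      ∀ ρ₀ : ℝ, 0 ≤ ρ₀ → ∀ ψ : ℝ → ℝ → ℝ, IsRWSolution M s ℓ r ψ →
        totalEnergy (linePotential M s ℓ r) ψ 0 < ⊤ →
        (∀ T ρ, ρ₀ ≤ ρ →
          channelEnergy (linePotential M s ℓ r) xc ρ (fun t x ↦ ψ (T + t) x) atTop = 0 ∧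
          channelEnergy (linePotential M s ℓ r) xc ρ (fun t x ↦ ψ (T + t) x) atBot = 0) →
        ∀ t x, ψ t x = 0 := by
  intro M _ r xc hr s ℓ hs hsℓ ρ₀ hρ₀ ψ hψ hE hsil t x
  refine futureSilentWavesVanish hr hs hsℓ hψ hE (fun T ↦ ?_) t x
  have h := (hsil (T + ρ₀) ρ₀ le_rfl).1
  rwa [channelEnergy_aperture_top₁ _ ψ xc hρ₀, show T + ρ₀ - ρ₀ = T by ring] at h

/-- **`SilentModesAreStatic`** (first lemma of the crux card `kerr-isolation-dichotomy`, VERBATIM the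
transcription `Disproof.SilentModesAreStatic`, now a theorem): under (unused) per-mode channel inequalities,
a globally bounded-energy `C²` Regge–Wheeler solution silent at every centre through every channel of
aperture `ρ ≥ ρ₀`, both time directions, is static — indeed zero (`RW.eternalSilentWavesVanish` at aperture
`max ρ₀ 0`; the Disproof's `silentModesAreStatic_of_eternalSilentWavesVanish`). [folklore] -/
theorem silentModesAreStatic :
    ∀ M : ℝ, 0 < M → ∀ (r : ℝ → ℝ) (xc : ℝ), IsTortoiseRadius M r xc → ∀ (s ℓ : ℕ), s ≤ 2 → s ≤ ℓ →
      ∀ (ρ₀ c : ℝ), 0 < c → (∀ ρ, ρ₀ ≤ ρ → ChannelInequality (linePotential M s ℓ r) xc ρ c) →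
      ∀ ψ : ℝ → ℝ → ℝ, IsRWSolution M s ℓ r ψ →
        (∃ E : ℝ≥0∞, E ≠ ⊤ ∧ ∀ t, totalEnergy (linePotential M s ℓ r) ψ t ≤ E) →
        (∀ t₀ ρ, ρ₀ ≤ ρ →
          channelEnergy (linePotential M s ℓ r) xc ρ (fun t x ↦ ψ (t₀ + t) x) atTop = 0 ∧
          channelEnergy (linePotential M s ℓ r) xc ρ (fun t x ↦ ψ (t₀ + t) x) atBot = 0) →
        ∀ t x, ψ t x = ψ 0 x := by
  intro M hM r xc hr s ℓ hs hsℓ ρ₀ c _ _ ψ hψ hE hsil t x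
  obtain ⟨E, hEtop, hEle⟩ := hE
  have hfin : totalEnergy (linePotential M s ℓ r) ψ 0 < ⊤ :=
    lt_of_le_of_lt (hEle 0) (lt_top_iff_ne_top.2 hEtop)
  have hsil' : ∀ T ρ, max ρ₀ 0 ≤ ρ →
      channelEnergy (linePotential M s ℓ r) xc ρ (fun t x ↦ ψ (T + t) x) atTop = 0 ∧
      channelEnergy (linePotential M s ℓ r) xc ρ (fun t x ↦ ψ (T + t) x) atBot = 0 :=
    fun T ρ hρ ↦ hsil T ρ ((le_max_left _ _).trans hρ)
  have hzero := eternalSilentWavesVanish M hM r xc hr s ℓ hs hsℓ (max ρ₀ 0) (le_max_right _ _) ψ hψ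
    hfin hsil'
  rw [hzero t x, hzero 0 x]

end RW

/-- **Registered summary stub `stub_rwEternalSilentWavesVanish`** (crux stmt-FinalStateConjecture-14075, line
`isolated-kerr-connected-hull`): `RW.eternalSilentWavesVanish`, fully qualified. [folklore] -/
theorem stub_rwEternalSilentWavesVanish :
    ∀ M : ℝ, 0 < M → ∀ (r : ℝ → ℝ) (xc : ℝ), ReggeWheeler.IsTortoiseRadius M r xc →
      ∀ (s ℓ : ℕ), s ≤ 2 → s ≤ ℓ → ∀ ρ₀ : ℝ, 0 ≤ ρ₀ → ∀ ψ : ℝ → ℝ → ℝ,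
        ReggeWheeler.IsRWSolution M s ℓ r ψ →
        ReggeWheeler.totalEnergy (ReggeWheeler.linePotential M s ℓ r) ψ 0 < ⊤ →
        (∀ T ρ, ρ₀ ≤ ρ →
          ReggeWheeler.channelEnergy (ReggeWheeler.linePotential M s ℓ r) xc ρ
              (fun t x ↦ ψ (T + t) x) Filter.atTop = 0 ∧
            ReggeWheeler.channelEnergy (ReggeWheeler.linePotential M s ℓ r) xc ρ
              (fun t x ↦ ψ (T + t) x) Filter.atBot = 0) →
        ∀ t x, ψ t x = 0 :=
  RW.eternalSilentWavesVanish

end Summit.FinalStateConjecture.FinalStateConjecture.Theorems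

end
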